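import Summits.QuantumFields.YangMills.Theorems.PoincareLipschitzTrueLinBoxLocalRows
import Summits.QuantumFields.YangMills.Theorems.UnitScaleTiltProp7TrueLinIterDefect
import Summits.QuantumFields.YangMills.Theorems.UnitScaleTiltProp7TrueLinSourcedDefectL1Rows
import HarnessLib

/-!
# Route `UnitScaleTilt`, crux K1 «MinimiserStabilityRegPr» (stmt-QuantumFields-19200), route-R (β) R0 REM2ˢ «(n3)₂-sym» = H2-1ˢ (px21 g7 LOCATE 3c6e40d5, file N3) —
# THE `k`-FOLD `ℓ²` PROPAGATION OF THE (SOURCED) REDUCED TRUE-LINEARISATION FAMILY, LOCALISED: `Σ_{c ∈ C_k}` ON THE LEFT, `Σ_{b ∈ C_0}` ON THE RIGHT,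
# FOR ANY NESTED FAMILY OF BOND SETS `C_i` CLOSED UNDER THE TWO-BLOCK NEIGHBOURHOODS, WINDOWS ASKED ON THE FAMILY ONLY

Cell `ym3-torus`, width seat `ym-ust-19200-w5` (gen 8), px21 g7's offer «N3 → any idle width» (07:50:10Z; px13 g6 «GO» 07:50:34Z).  THEOREMS ONLY (0 `def`,
0 `sorry`); `--supports stmt-QuantumFields-19200 --as helper`, count-neutral.  YM₃ on T³ is a ladder rung (R3), not the Clay problem; nothing here claims
`hN2s`, H2-1, `hMcomb₂`, (β), `hD`, the stub, the crux, d = 4 or the mass gap.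

THE POINT.  ✓`Prop7TrueLinIterDefect.sqrt_sum_normSq_reduced_le` ∕ ✓`Prop7TrueLinSourcedDefect.sqrt_sum_normSq_sourcedReduced_le` propagate the reduced
family `G_{j+1} = LINE_j(G_j) + D_j (+ R_j)` of ✓`Prop7TrueLinIterStructure` ∕ ✓`Prop7TrueLinSourcedStructure` in GLOBAL `ℓ²` along the background tower
(`ρ = √(L^{2−d})` per level from ✓`sum_normSq_line_le`, `κ·a_j` from ✓`sum_normSq_defect_le`).  px21's H2-1ˢ cure (sparse Λ-channel + level-0 localisation)
needs the same contraction with the sums RESTRICTED: coarse bonds in a finite family `C_{j+1}`, fine bonds in `C_j ⊇ ⋃_{c ∈ C_{j+1}} N(c)`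
(`N(c) = {b : blockOf b₋ ∈ {c₋, c₊}}`).  The one-step local rows are px7 g4's ✓`PoincareLipschitzTrueLinBoxLocalRows.sum_normSq_line_le_local` (E4-loc) and
✓`….sum_normSq_defect_le_local` (E5-loc) — cited BY NAME; this file is the finite-Minkowski step and the induction over a nested family, with a source term and a
free initial datum, so that both the sourceless first-order family (`G 0 = Y`, `R = 0`) and the sourced second-order family are served by one theorem.

WHAT IS PROVED (ns `…Theorems.Prop7TrueLinIterLocalL2`; any `Params`, any rank `n`; `T_j`, `P_V`, `CM_V`, `LINE_V` WRITTEN OUT as in ✓ p606268).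
* §1 `sqrt_sum_norm_add_sq_le_finset` — finite Minkowski over a `Finset` (the real recursion with a free initial datum is ✓`Prop7TrueLinSourcedDefectL1Rows.sourced_recursion_bound_init`).
* §2 ★ `sqrt_sum_normSq_step_le_local` — ONE LEVEL, any `SU(n)` level-`j` field `V`, any fields `Z` (level `j`), `R` (level `j+1`): for `S ⊇ ⋃_{c∈C} N(c)` and the
  (0.4) loop windows `dist1(W_i(c)) ≤ α ≤ 1/24`, `α < δ_N` asked for `c ∈ C` ONLY,
  `√(Σ_{c∈C} ‖T(V)Z(c) − P_{V̄}(CM_VZ)(c) + R(c)‖²) ≤ (ρ + κα)·√(Σ_{b∈S} ‖Z b‖²) + √(Σ_{c∈C} ‖R c‖²)`.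
* §3 ★★ `sqrt_sum_normSq_sourcedReduced_le_local` — THE TOWER: background `Ū₀^{(j)} = Averaging.iter (blockAvg ℰp) j U₀`, `k ≤ m + K`; nested bond families
  `C : (i : ℕ) → Finset (PBond P i)` with `∀ i < k, ∀ c ∈ C (i+1), N(c) ⊆ C i`; the sourced reduced family (`hGs`, free `G 0`); windows on `C (i+1)` only:
  `√(Σ_{c∈C k} ‖G k c‖²) ≤ exp((κ/ρ)Σ_{j<k} a j)·(ρ^k·√(Σ_{b∈C 0} ‖G 0 b‖²) + Σ_{j<k} ρ^{k−1−j}·√(Σ_{c∈C (j+1)} ‖R j c‖²))`.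
* §4 ★★ `sqrt_sum_normSq_reduced_le_local` ∕ `sum_normSq_reduced_le_local` — the sourceless family (✓ p606268's `hGs` VERBATIM): `√(Σ_{C k}‖G k‖²) ≤ ρ^k·exp(…)·√(Σ_{C 0}‖G 0‖²)`
  and its square `Σ_{c∈C k}‖G k c‖² ≤ ((L^d)⁻¹L²)^k·exp(2(κ/ρ)Σ a)·Σ_{b∈C 0}‖G 0 b‖²` — px21's N3 shape `(L^{2−d}·(1 + c·a)²)^{j}·Σ_{A(0)}` (with `1 + x ≤ eˣ`).
HONEST SCOPE.  Bookkeeping over landed one-step rows; no new analysis; the choice of the families `C i` (N4) and the exponent count (N5) are NOT here.  `ρ`, `κ` are the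
letters of ✓`Prop7TrueLinIterDefect`.  References: T. Bałaban, CMP 95 (1984) 17–40 [Balaban1984PropagatorsI] ((1.11), (1.18)–(1.20) pp.19–20); CMP 98 (1985) 17–51
[Balaban1985Averaging] (Prop. 3 (124)–(126) p.36); CMP 109 (1987) 249–301 [Balaban1987RG1] ((0.3)–(0.4) pp.252–253).
-/

set_option autoImplicit false

noncomputable section

open scoped BigOperators Matrix.Norms.L2Operator

namespace Summit.QuantumFields.YangMills.Theorems.Prop7TrueLinIterLocalL2

open Literature.MathematicalPhysics.QuantumFieldTheory.Balaban1983to89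
open Finset T4Continuum BlockAveraging AveragingRT ExpMeanLog BlockAveragingEMLLinearised BlockAveragingEMLLinearisedBackground BlockAveragingEMLProp2
open Summit.QuantumFields.YangMills.Theorems.Prop7TrueLinLineBound (line_sub)
open Summit.QuantumFields.YangMills.Theorems.Prop7TrueLinIterDefect (sqrt_sum_norm_add_sq_le sqrt_le_sqrt_mul_of_sq_le)
open Summit.QuantumFields.YangMills.Theorems.PoincareLipschitzTrueLinBoxLocalRows (sum_normSq_line_le_local sum_normSq_defect_le_local)
open Summit.QuantumFields.YangMills.Theorems.Prop7TrueLinSourcedDefectL1Rows (sourced_recursion_bound_init)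

variable {P : Params} {n : Type*} [Fintype n] [DecidableEq n] [Nonempty n] {j : ℕ}

/-! ## §1 Finite Minkowski over a `Finset` -/

omit [Fintype n] [DecidableEq n] [Nonempty n] in
/-- Finite Minkowski in `ℓ²` over a `Finset`: `√(Σ_{i∈s}‖f i + g i‖²) ≤ √(Σ_{i∈s}‖f i‖²) + √(Σ_{i∈s}‖g i‖²)` (✓`sqrt_sum_norm_add_sq_le` on the subtype `↥s`). [folklore] -/
theorem sqrt_sum_norm_add_sq_le_finset {ι E : Type*} [SeminormedAddCommGroup E] (s : Finset ι) (f g : ι → E) :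
    Real.sqrt (∑ i ∈ s, ‖f i + g i‖ ^ 2) ≤ Real.sqrt (∑ i ∈ s, ‖f i‖ ^ 2) + Real.sqrt (∑ i ∈ s, ‖g i‖ ^ 2) := by
  rw [← Finset.sum_coe_sort s (fun i => ‖f i + g i‖ ^ 2), ← Finset.sum_coe_sort s (fun i => ‖f i‖ ^ 2),
    ← Finset.sum_coe_sort s (fun i => ‖g i‖ ^ 2)]
  exact sqrt_sum_norm_add_sq_le (fun i : s => f i) (fun i : s => g i)

/-! ## §2 ★ One level, localised: the sourced reduced step in `ℓ²(C)` against `ℓ²(S)` -/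

/-- ★ **THE LOCAL ONE-STEP `ℓ²` ROW OF THE (SOURCED) REDUCED TRUE LINEARISATION.**  Level `j + 1 ≤ m + K`; `V` any `SU(n)` level-`j` field, `V̄ = avgFun ℰp V`;
`Z` a level-`j` bond field, `R` a level-`(j+1)` bond field; `C` a finite family of coarse bonds and `S ⊇ ⋃_{c∈C} N(c)` (`hS`); (0.4) loop windows
`dist1(loopHol V c i) ≤ α` for `c ∈ C` ONLY (`α ≤ 1/24`, `α < δ_N`).  Then, with `ρ = √((L^d)⁻¹L²)`, `κα = 159·(d+2)L·√((2dL^d)(2d))·α`,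
`√(Σ_{c∈C} ‖T(V)Z(c) − P_{V̄}(CM_VZ)(c) + R(c)‖²) ≤ (ρ + κα)·√(Σ_{b∈S} ‖Z b‖²) + √(Σ_{c∈C} ‖R c‖²)`
(`T(V)Z − P(CM Z) = D + LINE`, finite Minkowski, E5-loc ✓`sum_normSq_defect_le_local`, E4-loc ✓`sum_normSq_line_le_local`).
[cite: Balaban1984PropagatorsI, (1.18)-(1.20) pp.19-20; Balaban1985Averaging, Prop. 3 (124)-(126) p.36] -/
theorem sqrt_sum_normSq_step_le_local (hj : j + 1 ≤ P.m + P.K) (V : GaugeField P j (Matrix.specialUnitaryGroup n ℂ))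
    (Z : PBond P j → Matrix n n ℂ) (R : PBond P (j + 1) → Matrix n n ℂ)
    (C : Finset (PBond P (j + 1))) (S : Finset (PBond P j))
    (hS : ∀ c ∈ C, ∀ b : PBond P j, (blockOf b.src = c.src ∨ blockOf b.src = c.tgt) → b ∈ S)
    {α : ℝ} (hα0 : 0 ≤ α) (hα : ∀ c ∈ C, ∀ i : Idx P, dist1 (loopHol V c i) ≤ α) (hα24 : α ≤ 1 / 24) (hN : α < deltaSU n) :
    Real.sqrt (∑ c ∈ C,
      ‖(fderiv ℂ (eml : (Idx P → Matrix n n ℂ) → Matrix n n ℂ) (fun i => ((loopHol V c i : Matrix.specialUnitaryGroup n ℂ) : Matrix n n ℂ))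
          (fun i => covWalkSum V Z (walk (emb c.src) (loopWord P.L c.dir (off i.1) i.2.1 i.2.2))
            * ((loopHol V c i : Matrix.specialUnitaryGroup n ℂ) : Matrix n n ℂ))
          * star ((corr (expMeanLogSU (n := n)) V c : Matrix.specialUnitaryGroup n ℂ) : Matrix n n ℂ)
        + ((corr (expMeanLogSU (n := n)) V c : Matrix.specialUnitaryGroup n ℂ) : Matrix n n ℂ)
          * covWalkSum V Z (walk (emb c.src) (List.replicate P.L (c.dir, true)))
          * star ((corr (expMeanLogSU (n := n)) V c : Matrix.specialUnitaryGroup n ℂ) : Matrix n n ℂ))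
      - ((((Fintype.card (Idx P) : ℂ))⁻¹ • ∑ i : Idx P, covWalkSum V Z (walk (emb c.src) (stairWord i.2.1 (off i.1))))
          - ((avgFun (expMeanLogSU (n := n)) V c : Matrix.specialUnitaryGroup n ℂ) : Matrix n n ℂ)
              * (((Fintype.card (Idx P) : ℂ))⁻¹ • ∑ i : Idx P, covWalkSum V Z (walk (emb c.tgt) (stairWord i.2.1 (off i.1))))
              * star ((avgFun (expMeanLogSU (n := n)) V c : Matrix.specialUnitaryGroup n ℂ) : Matrix n n ℂ))
      + R c‖ ^ 2)
      ≤ (Real.sqrt (((P.L : ℝ) ^ P.d)⁻¹ * (P.L : ℝ) ^ 2) + (159 * (((P.d + 2) * P.L : ℕ) : ℝ) * Real.sqrt (2 * P.d * (P.L : ℝ) ^ P.d * (2 * P.d))) * α)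
          * Real.sqrt (∑ b ∈ S, ‖Z b‖ ^ 2)
        + Real.sqrt (∑ c ∈ C, ‖R c‖ ^ 2) := by
  have hLpos : (0 : ℝ) < (P.L : ℝ) := by exact_mod_cast P.L_pos
  have hcL : (0 : ℝ) < ((P.L : ℝ) ^ P.d)⁻¹ * (P.L : ℝ) ^ 2 := by positivity
  -- the level-`j` defect `D` and the `LINE` part, as functions of the coarse bond
  set D : PBond P (j + 1) → Matrix n n ℂ := fun c =>
    (fderiv ℂ (eml : (Idx P → Matrix n n ℂ) → Matrix n n ℂ) (fun i => ((loopHol V c i : Matrix.specialUnitaryGroup n ℂ) : Matrix n n ℂ))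
        (fun i => covWalkSum V Z (walk (emb c.src) (loopWord P.L c.dir (off i.1) i.2.1 i.2.2))
          * ((loopHol V c i : Matrix.specialUnitaryGroup n ℂ) : Matrix n n ℂ))
        * star ((corr (expMeanLogSU (n := n)) V c : Matrix.specialUnitaryGroup n ℂ) : Matrix n n ℂ)
      + ((corr (expMeanLogSU (n := n)) V c : Matrix.specialUnitaryGroup n ℂ) : Matrix n n ℂ)
        * covWalkSum V Z (walk (emb c.src) (List.replicate P.L (c.dir, true)))
        * star ((corr (expMeanLogSU (n := n)) V c : Matrix.specialUnitaryGroup n ℂ) : Matrix n n ℂ))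
    - ((((Fintype.card (Idx P) : ℂ))⁻¹ • ∑ i : Idx P, covWalkSum V Z (walk (emb c.src) (stairWord i.2.1 (off i.1))))
        - ((avgFun (expMeanLogSU (n := n)) V c : Matrix.specialUnitaryGroup n ℂ) : Matrix n n ℂ)
            * (((Fintype.card (Idx P) : ℂ))⁻¹ • ∑ i : Idx P, covWalkSum V Z (walk (emb c.tgt) (stairWord i.2.1 (off i.1))))
            * star ((avgFun (expMeanLogSU (n := n)) V c : Matrix.specialUnitaryGroup n ℂ) : Matrix n n ℂ))
    - ((Fintype.card (Idx P) : ℂ))⁻¹ • ∑ i : Idx P,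
        ((holAt V (walk (emb c.src) (stairWord i.2.1 (off i.1))) : Matrix.specialUnitaryGroup n ℂ) : Matrix n n ℂ) *
          covWalkSum V Z (walk (walkEnd (emb c.src) (stairWord i.2.1 (off i.1))) (List.replicate P.L (c.dir, true))) *
        star ((holAt V (walk (emb c.src) (stairWord i.2.1 (off i.1))) : Matrix.specialUnitaryGroup n ℂ) : Matrix n n ℂ) with hD
  set LG : PBond P (j + 1) → Matrix n n ℂ := fun c => ((Fintype.card (Idx P) : ℂ))⁻¹ • ∑ i : Idx P,
        ((holAt V (walk (emb c.src) (stairWord i.2.1 (off i.1))) : Matrix.specialUnitaryGroup n ℂ) : Matrix n n ℂ) *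
          covWalkSum V Z (walk (walkEnd (emb c.src) (stairWord i.2.1 (off i.1))) (List.replicate P.L (c.dir, true))) *
        star ((holAt V (walk (emb c.src) (stairWord i.2.1 (off i.1))) : Matrix.specialUnitaryGroup n ℂ) : Matrix n n ℂ) with hLG
  -- the decomposition `T(V)Z − P(CM Z) + R = (D + LINE) + R`
  have hdec : ∀ c,
      (fderiv ℂ (eml : (Idx P → Matrix n n ℂ) → Matrix n n ℂ) (fun i => ((loopHol V c i : Matrix.specialUnitaryGroup n ℂ) : Matrix n n ℂ))
          (fun i => covWalkSum V Z (walk (emb c.src) (loopWord P.L c.dir (off i.1) i.2.1 i.2.2))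
            * ((loopHol V c i : Matrix.specialUnitaryGroup n ℂ) : Matrix n n ℂ))
          * star ((corr (expMeanLogSU (n := n)) V c : Matrix.specialUnitaryGroup n ℂ) : Matrix n n ℂ)
        + ((corr (expMeanLogSU (n := n)) V c : Matrix.specialUnitaryGroup n ℂ) : Matrix n n ℂ)
          * covWalkSum V Z (walk (emb c.src) (List.replicate P.L (c.dir, true)))
          * star ((corr (expMeanLogSU (n := n)) V c : Matrix.specialUnitaryGroup n ℂ) : Matrix n n ℂ))
      - ((((Fintype.card (Idx P) : ℂ))⁻¹ • ∑ i : Idx P, covWalkSum V Z (walk (emb c.src) (stairWord i.2.1 (off i.1))))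
          - ((avgFun (expMeanLogSU (n := n)) V c : Matrix.specialUnitaryGroup n ℂ) : Matrix n n ℂ)
              * (((Fintype.card (Idx P) : ℂ))⁻¹ • ∑ i : Idx P, covWalkSum V Z (walk (emb c.tgt) (stairWord i.2.1 (off i.1))))
              * star ((avgFun (expMeanLogSU (n := n)) V c : Matrix.specialUnitaryGroup n ℂ) : Matrix n n ℂ))
      + R c = (D c + LG c) + R c := by
    intro c
    simp only [hD, hLG]
    abel
  -- the two local `ℓ²` rows in square-root form
  have hDrow : Real.sqrt (∑ c ∈ C, ‖D c‖ ^ 2)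
      ≤ (159 * (((P.d + 2) * P.L : ℕ) : ℝ) * Real.sqrt (2 * P.d * (P.L : ℝ) ^ P.d * (2 * P.d))) * α * Real.sqrt (∑ b ∈ S, ‖Z b‖ ^ 2) := by
    have h := sum_normSq_defect_le_local hj V Z C S hS hα hα24 hN
    have h' : ∑ c ∈ C, ‖D c‖ ^ 2 ≤ ((159 * α * (((P.d + 2) * P.L : ℕ) : ℝ)) ^ 2 * (2 * P.d * (P.L : ℝ) ^ P.d * (2 * P.d))) * ∑ b ∈ S, ‖Z b‖ ^ 2 := by
      simpa only [hD, mul_assoc] using h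
    have h1 := sqrt_le_sqrt_mul_of_sq_le (by positivity) h'
    have h2 : Real.sqrt ((159 * α * (((P.d + 2) * P.L : ℕ) : ℝ)) ^ 2 * (2 * P.d * (P.L : ℝ) ^ P.d * (2 * P.d)))
        = (159 * (((P.d + 2) * P.L : ℕ) : ℝ) * Real.sqrt (2 * P.d * (P.L : ℝ) ^ P.d * (2 * P.d))) * α := by
      rw [Real.sqrt_mul (sq_nonneg _), Real.sqrt_sq (by positivity)]
      ring
    rw [h2] at h1
    exact h1
  have hLGrow : Real.sqrt (∑ c ∈ C, ‖LG c‖ ^ 2) ≤ Real.sqrt (((P.L : ℝ) ^ P.d)⁻¹ * (P.L : ℝ) ^ 2) * Real.sqrt (∑ b ∈ S, ‖Z b‖ ^ 2) := by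
    have h := sum_normSq_line_le_local hj V Z C S hS
    exact sqrt_le_sqrt_mul_of_sq_le hcL.le (by simpa only [hLG] using h)
  calc _ = Real.sqrt (∑ c ∈ C, ‖(D c + LG c) + R c‖ ^ 2) := by simp only [hdec]
    _ ≤ Real.sqrt (∑ c ∈ C, ‖D c + LG c‖ ^ 2) + Real.sqrt (∑ c ∈ C, ‖R c‖ ^ 2) := sqrt_sum_norm_add_sq_le_finset C _ _
    _ ≤ (Real.sqrt (∑ c ∈ C, ‖D c‖ ^ 2) + Real.sqrt (∑ c ∈ C, ‖LG c‖ ^ 2)) + Real.sqrt (∑ c ∈ C, ‖R c‖ ^ 2) :=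
        add_le_add (sqrt_sum_norm_add_sq_le_finset C D LG) le_rfl
    _ ≤ ((159 * (((P.d + 2) * P.L : ℕ) : ℝ) * Real.sqrt (2 * P.d * (P.L : ℝ) ^ P.d * (2 * P.d))) * α * Real.sqrt (∑ b ∈ S, ‖Z b‖ ^ 2)
          + Real.sqrt (((P.L : ℝ) ^ P.d)⁻¹ * (P.L : ℝ) ^ 2) * Real.sqrt (∑ b ∈ S, ‖Z b‖ ^ 2)) + Real.sqrt (∑ c ∈ C, ‖R c‖ ^ 2) :=
        add_le_add (add_le_add hDrow hLGrow) le_rfl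
    _ = _ := by ring

/-! ## §3 ★★ The tower, localised on a nested family of bond sets -/

section Tower

variable (U₀ : GaugeField P 0 (Matrix.specialUnitaryGroup n ℂ)) (R : (k : ℕ) → PBond P (k + 1) → Matrix n n ℂ)
  (G : (k : ℕ) → PBond P k → Matrix n n ℂ)
  (hGs : ∀ (k : ℕ) (c : PBond P (k + 1)), G (k + 1) c
      = (fderiv ℂ (eml : (Idx P → Matrix n n ℂ) → Matrix n n ℂ)
            (fun i => ((loopHol (Averaging.iter (fun i => blockAvg (P := P) (j := i) (expMeanLogSU (n := n))) k U₀) c i :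
              Matrix.specialUnitaryGroup n ℂ) : Matrix n n ℂ))
            (fun i => covWalkSum (Averaging.iter (fun i => blockAvg (P := P) (j := i) (expMeanLogSU (n := n))) k U₀) (G k)
                (walk (emb c.src) (loopWord P.L c.dir (off i.1) i.2.1 i.2.2))
              * ((loopHol (Averaging.iter (fun i => blockAvg (P := P) (j := i) (expMeanLogSU (n := n))) k U₀) c i :
                Matrix.specialUnitaryGroup n ℂ) : Matrix n n ℂ))
            * star ((corr (expMeanLogSU (n := n)) (Averaging.iter (fun i => blockAvg (P := P) (j := i) (expMeanLogSU (n := n))) k U₀) c :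
                Matrix.specialUnitaryGroup n ℂ) : Matrix n n ℂ)
          + ((corr (expMeanLogSU (n := n)) (Averaging.iter (fun i => blockAvg (P := P) (j := i) (expMeanLogSU (n := n))) k U₀) c :
                Matrix.specialUnitaryGroup n ℂ) : Matrix n n ℂ)
            * covWalkSum (Averaging.iter (fun i => blockAvg (P := P) (j := i) (expMeanLogSU (n := n))) k U₀) (G k)
                (walk (emb c.src) (List.replicate P.L (c.dir, true)))
            * star ((corr (expMeanLogSU (n := n)) (Averaging.iter (fun i => blockAvg (P := P) (j := i) (expMeanLogSU (n := n))) k U₀) c :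
                Matrix.specialUnitaryGroup n ℂ) : Matrix n n ℂ))
        - ((((Fintype.card (Idx P) : ℂ))⁻¹ • ∑ i : Idx P,
              covWalkSum (Averaging.iter (fun i => blockAvg (P := P) (j := i) (expMeanLogSU (n := n))) k U₀) (G k) (walk (emb c.src) (stairWord i.2.1 (off i.1))))
            - ((Averaging.iter (fun i => blockAvg (P := P) (j := i) (expMeanLogSU (n := n))) (k + 1) U₀ c : Matrix.specialUnitaryGroup n ℂ) :
                Matrix n n ℂ)
              * (((Fintype.card (Idx P) : ℂ))⁻¹ • ∑ i : Idx P,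
                  covWalkSum (Averaging.iter (fun i => blockAvg (P := P) (j := i) (expMeanLogSU (n := n))) k U₀) (G k) (walk (emb c.tgt) (stairWord i.2.1 (off i.1))))
              * star ((Averaging.iter (fun i => blockAvg (P := P) (j := i) (expMeanLogSU (n := n))) (k + 1) U₀ c :
                Matrix.specialUnitaryGroup n ℂ) : Matrix n n ℂ))
        + R k c)

include hGs in
/-- ★★ **THE SOURCED REDUCED FAMILY IN LOCAL `ℓ²`, ALONG THE TOWER.**  Background tower `Ū₀^{(j)} = Averaging.iter (blockAvg ℰp) j U₀`, standing range `k ≤ m + K`;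
`G` the sourced reduced family at the covariant comb mean (`hGs`: `G (j+1) c = T_j(G j)(c) − P_{Ū₀^{(j+1)}}(CM_j(G j))(c) + R j c`, `G 0` FREE); a NESTED family of bond sets
`C i : Finset (PBond P i)` closed under the two-block neighbourhoods (`hnest : ∀ i < k, ∀ c ∈ C (i+1), N(c) ⊆ C i`); per-level (0.4) loop sizes `dist1(W^{(j)}_i(c)) ≤ a j`
asked for `c ∈ C (j+1)` ONLY, `a j ≤ 1/24`, `a j < δ_N`.  Then with `ρ = √((L^d)⁻¹L²)`, `κ = 159·(d+2)L·√((2dL^d)(2d))`: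
`√(Σ_{c∈C k} ‖G k c‖²) ≤ exp((κ/ρ)·Σ_{j<k} a j)·(ρ^k·√(Σ_{b∈C 0} ‖G 0 b‖²) + Σ_{j<k} ρ^{k−1−j}·√(Σ_{c∈C (j+1)} ‖R j c‖²))`.
[cite: Balaban1984PropagatorsI, (1.18)-(1.20) pp.19-20; Balaban1985Averaging, Prop. 3 (124)-(126) p.36] -/
theorem sqrt_sum_normSq_sourcedReduced_le_local (a : ℕ → ℝ) (ha0 : ∀ j, 0 ≤ a j) {k : ℕ} (hk : k ≤ P.m + P.K)
    (C : (i : ℕ) → Finset (PBond P i))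
    (hnest : ∀ i < k, ∀ c ∈ C (i + 1), ∀ b : PBond P i, (blockOf b.src = c.src ∨ blockOf b.src = c.tgt) → b ∈ C i)
    (hα : ∀ j < k, ∀ c ∈ C (j + 1), ∀ i : Idx P,
        dist1 (loopHol (Averaging.iter (fun i => blockAvg (P := P) (j := i) (expMeanLogSU (n := n))) j U₀) c i) ≤ a j)
    (ha24 : ∀ j < k, a j ≤ 1 / 24) (haN : ∀ j < k, a j < deltaSU n) :
    Real.sqrt (∑ c ∈ C k, ‖G k c‖ ^ 2)
      ≤ Real.exp ((159 * (((P.d + 2) * P.L : ℕ) : ℝ) * Real.sqrt (2 * P.d * (P.L : ℝ) ^ P.d * (2 * P.d)))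
            / Real.sqrt (((P.L : ℝ) ^ P.d)⁻¹ * (P.L : ℝ) ^ 2) * ∑ j ∈ Finset.range k, a j)
        * (Real.sqrt (((P.L : ℝ) ^ P.d)⁻¹ * (P.L : ℝ) ^ 2) ^ k * Real.sqrt (∑ b ∈ C 0, ‖G 0 b‖ ^ 2)
          + ∑ j ∈ Finset.range k, Real.sqrt (((P.L : ℝ) ^ P.d)⁻¹ * (P.L : ℝ) ^ 2) ^ (k - 1 - j)
              * Real.sqrt (∑ c ∈ C (j + 1), ‖R j c‖ ^ 2)) := by
  have hLpos : (0 : ℝ) < (P.L : ℝ) := by exact_mod_cast P.L_pos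
  have hcL : (0 : ℝ) < ((P.L : ℝ) ^ P.d)⁻¹ * (P.L : ℝ) ^ 2 := by positivity
  have hρpos : 0 < Real.sqrt (((P.L : ℝ) ^ P.d)⁻¹ * (P.L : ℝ) ^ 2) := Real.sqrt_pos.2 hcL
  have hκ0 : 0 ≤ 159 * (((P.d + 2) * P.L : ℕ) : ℝ) * Real.sqrt (2 * P.d * (P.L : ℝ) ^ P.d * (2 * P.d)) := by positivity
  -- the per-level local rows `g (j+1) ≤ (ρ + κ a j) g j + r j`
  have hrows : ∀ j < k, Real.sqrt (∑ c ∈ C (j + 1), ‖G (j + 1) c‖ ^ 2)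
      ≤ (Real.sqrt (((P.L : ℝ) ^ P.d)⁻¹ * (P.L : ℝ) ^ 2)
            + (159 * (((P.d + 2) * P.L : ℕ) : ℝ) * Real.sqrt (2 * P.d * (P.L : ℝ) ^ P.d * (2 * P.d))) * a j)
          * Real.sqrt (∑ b ∈ C j, ‖G j b‖ ^ 2)
        + Real.sqrt (∑ c ∈ C (j + 1), ‖R j c‖ ^ 2) := by
    intro j hj
    have hj1 : j + 1 ≤ P.m + P.K := by omega
    have hiter : Averaging.iter (fun i => blockAvg (P := P) (j := i) (expMeanLogSU (n := n))) (j + 1) U₀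
        = avgFun (expMeanLogSU (n := n)) (Averaging.iter (fun i => blockAvg (P := P) (j := i) (expMeanLogSU (n := n))) j U₀) := rfl
    have h := sqrt_sum_normSq_step_le_local hj1 (Averaging.iter (fun i => blockAvg (P := P) (j := i) (expMeanLogSU (n := n))) j U₀)
      (G j) (R j) (C (j + 1)) (C j) (hnest j hj) (ha0 j) (hα j hj) (ha24 j hj) (haN j hj)
    have hG : ∀ c ∈ C (j + 1), ‖G (j + 1) c‖ ^ 2 = ‖(fderiv ℂ (eml : (Idx P → Matrix n n ℂ) → Matrix n n ℂ)
          (fun i => ((loopHol (Averaging.iter (fun i => blockAvg (P := P) (j := i) (expMeanLogSU (n := n))) j U₀) c i :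
            Matrix.specialUnitaryGroup n ℂ) : Matrix n n ℂ))
          (fun i => covWalkSum (Averaging.iter (fun i => blockAvg (P := P) (j := i) (expMeanLogSU (n := n))) j U₀) (G j)
              (walk (emb c.src) (loopWord P.L c.dir (off i.1) i.2.1 i.2.2))
            * ((loopHol (Averaging.iter (fun i => blockAvg (P := P) (j := i) (expMeanLogSU (n := n))) j U₀) c i :
              Matrix.specialUnitaryGroup n ℂ) : Matrix n n ℂ))
          * star ((corr (expMeanLogSU (n := n)) (Averaging.iter (fun i => blockAvg (P := P) (j := i) (expMeanLogSU (n := n))) j U₀) c :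
              Matrix.specialUnitaryGroup n ℂ) : Matrix n n ℂ)
        + ((corr (expMeanLogSU (n := n)) (Averaging.iter (fun i => blockAvg (P := P) (j := i) (expMeanLogSU (n := n))) j U₀) c :
              Matrix.specialUnitaryGroup n ℂ) : Matrix n n ℂ)
          * covWalkSum (Averaging.iter (fun i => blockAvg (P := P) (j := i) (expMeanLogSU (n := n))) j U₀) (G j)
              (walk (emb c.src) (List.replicate P.L (c.dir, true)))
          * star ((corr (expMeanLogSU (n := n)) (Averaging.iter (fun i => blockAvg (P := P) (j := i) (expMeanLogSU (n := n))) j U₀) c :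
              Matrix.specialUnitaryGroup n ℂ) : Matrix n n ℂ))
      - ((((Fintype.card (Idx P) : ℂ))⁻¹ • ∑ i : Idx P,
            covWalkSum (Averaging.iter (fun i => blockAvg (P := P) (j := i) (expMeanLogSU (n := n))) j U₀) (G j) (walk (emb c.src) (stairWord i.2.1 (off i.1))))
          - ((avgFun (expMeanLogSU (n := n)) (Averaging.iter (fun i => blockAvg (P := P) (j := i) (expMeanLogSU (n := n))) j U₀) c :
              Matrix.specialUnitaryGroup n ℂ) : Matrix n n ℂ)
            * (((Fintype.card (Idx P) : ℂ))⁻¹ • ∑ i : Idx P,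
                covWalkSum (Averaging.iter (fun i => blockAvg (P := P) (j := i) (expMeanLogSU (n := n))) j U₀) (G j) (walk (emb c.tgt) (stairWord i.2.1 (off i.1))))
            * star ((avgFun (expMeanLogSU (n := n)) (Averaging.iter (fun i => blockAvg (P := P) (j := i) (expMeanLogSU (n := n))) j U₀) c :
              Matrix.specialUnitaryGroup n ℂ) : Matrix n n ℂ))
      + R j c‖ ^ 2 := by
      intro c _
      rw [hGs j c, hiter]
    rw [Finset.sum_congr rfl hG]
    exact h
  exact sourced_recursion_bound_init hρpos hκ0 a (fun j => Real.sqrt (∑ c ∈ C j, ‖G j c‖ ^ 2))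
    (fun j => Real.sqrt (∑ c ∈ C (j + 1), ‖R j c‖ ^ 2)) ha0 (fun j => Real.sqrt_nonneg _) (fun j => Real.sqrt_nonneg _) k hrows

end Tower

/-! ## §4 ★★ The sourceless family (first order), localised: square-root and squared forms -/

section Sourceless

variable (U₀ : GaugeField P 0 (Matrix.specialUnitaryGroup n ℂ)) (G : (k : ℕ) → PBond P k → Matrix n n ℂ)
  (hGs : ∀ (k : ℕ) (c : PBond P (k + 1)), G (k + 1) c
      = (fderiv ℂ (eml : (Idx P → Matrix n n ℂ) → Matrix n n ℂ)
            (fun i => ((loopHol (Averaging.iter (fun i => blockAvg (P := P) (j := i) (expMeanLogSU (n := n))) k U₀) c i :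
              Matrix.specialUnitaryGroup n ℂ) : Matrix n n ℂ))
            (fun i => covWalkSum (Averaging.iter (fun i => blockAvg (P := P) (j := i) (expMeanLogSU (n := n))) k U₀) (G k)
                (walk (emb c.src) (loopWord P.L c.dir (off i.1) i.2.1 i.2.2))
              * ((loopHol (Averaging.iter (fun i => blockAvg (P := P) (j := i) (expMeanLogSU (n := n))) k U₀) c i :
                Matrix.specialUnitaryGroup n ℂ) : Matrix n n ℂ))
            * star ((corr (expMeanLogSU (n := n)) (Averaging.iter (fun i => blockAvg (P := P) (j := i) (expMeanLogSU (n := n))) k U₀) c :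
                Matrix.specialUnitaryGroup n ℂ) : Matrix n n ℂ)
          + ((corr (expMeanLogSU (n := n)) (Averaging.iter (fun i => blockAvg (P := P) (j := i) (expMeanLogSU (n := n))) k U₀) c :
                Matrix.specialUnitaryGroup n ℂ) : Matrix n n ℂ)
            * covWalkSum (Averaging.iter (fun i => blockAvg (P := P) (j := i) (expMeanLogSU (n := n))) k U₀) (G k)
                (walk (emb c.src) (List.replicate P.L (c.dir, true)))
            * star ((corr (expMeanLogSU (n := n)) (Averaging.iter (fun i => blockAvg (P := P) (j := i) (expMeanLogSU (n := n))) k U₀) c :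
                Matrix.specialUnitaryGroup n ℂ) : Matrix n n ℂ))
        - ((((Fintype.card (Idx P) : ℂ))⁻¹ • ∑ i : Idx P,
              covWalkSum (Averaging.iter (fun i => blockAvg (P := P) (j := i) (expMeanLogSU (n := n))) k U₀) (G k) (walk (emb c.src) (stairWord i.2.1 (off i.1))))
            - ((Averaging.iter (fun i => blockAvg (P := P) (j := i) (expMeanLogSU (n := n))) (k + 1) U₀ c : Matrix.specialUnitaryGroup n ℂ) :
                Matrix n n ℂ)
              * (((Fintype.card (Idx P) : ℂ))⁻¹ • ∑ i : Idx P,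
                  covWalkSum (Averaging.iter (fun i => blockAvg (P := P) (j := i) (expMeanLogSU (n := n))) k U₀) (G k) (walk (emb c.tgt) (stairWord i.2.1 (off i.1))))
              * star ((Averaging.iter (fun i => blockAvg (P := P) (j := i) (expMeanLogSU (n := n))) (k + 1) U₀ c :
                Matrix.specialUnitaryGroup n ℂ) : Matrix n n ℂ)))

include hGs in
/-- ★★ **THE (SOURCELESS) REDUCED FAMILY IN LOCAL `ℓ²`, ALONG THE TOWER** — ✓ p606268's recursion `hGs` VERBATIM (`G 0` free, e.g. `G 0 = Y`), a nested family of bond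
sets `C i` closed under the two-block neighbourhoods, per-level loop sizes asked on `C (j+1)` only:
`√(Σ_{c∈C k} ‖G k c‖²) ≤ ρ^k·exp((κ/ρ)·Σ_{j<k} a j)·√(Σ_{b∈C 0} ‖G 0 b‖²)` (`ρ = √((L^d)⁻¹L²)`, `κ = 159·(d+2)L·√((2dL^d)(2d))`) — the local twin of
✓`Prop7TrueLinIterDefect.sqrt_sum_normSq_reduced_le`. [cite: Balaban1984PropagatorsI, (1.18)-(1.20) pp.19-20; Balaban1985Averaging, Prop. 3 (124)-(126) p.36] -/
theorem sqrt_sum_normSq_reduced_le_local (a : ℕ → ℝ) (ha0 : ∀ j, 0 ≤ a j) {k : ℕ} (hk : k ≤ P.m + P.K)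
    (C : (i : ℕ) → Finset (PBond P i))
    (hnest : ∀ i < k, ∀ c ∈ C (i + 1), ∀ b : PBond P i, (blockOf b.src = c.src ∨ blockOf b.src = c.tgt) → b ∈ C i)
    (hα : ∀ j < k, ∀ c ∈ C (j + 1), ∀ i : Idx P,
        dist1 (loopHol (Averaging.iter (fun i => blockAvg (P := P) (j := i) (expMeanLogSU (n := n))) j U₀) c i) ≤ a j)
    (ha24 : ∀ j < k, a j ≤ 1 / 24) (haN : ∀ j < k, a j < deltaSU n) :
    Real.sqrt (∑ c ∈ C k, ‖G k c‖ ^ 2)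
      ≤ Real.sqrt (((P.L : ℝ) ^ P.d)⁻¹ * (P.L : ℝ) ^ 2) ^ k
        * Real.exp ((159 * (((P.d + 2) * P.L : ℕ) : ℝ) * Real.sqrt (2 * P.d * (P.L : ℝ) ^ P.d * (2 * P.d)))
            / Real.sqrt (((P.L : ℝ) ^ P.d)⁻¹ * (P.L : ℝ) ^ 2) * ∑ j ∈ Finset.range k, a j)
        * Real.sqrt (∑ b ∈ C 0, ‖G 0 b‖ ^ 2) := by
  have h := sqrt_sum_normSq_sourcedReduced_le_local U₀ (fun _ _ => 0) G (fun k c => by rw [hGs k c, add_zero]) a ha0 hk C hnest hα ha24 haN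
  have h0 : ∑ j ∈ Finset.range k, Real.sqrt (((P.L : ℝ) ^ P.d)⁻¹ * (P.L : ℝ) ^ 2) ^ (k - 1 - j)
      * Real.sqrt (∑ c ∈ C (j + 1), ‖(0 : Matrix n n ℂ)‖ ^ 2) = 0 := by
    simp
  rw [h0, add_zero] at h
  calc _ ≤ _ := h
    _ = _ := by ring

include hGs in
/-- ★★ **SQUARED FORM** (px21's N3 shape): `Σ_{c∈C k} ‖G k c‖² ≤ ((L^d)⁻¹·L²)^k·exp(2·(κ/ρ)·Σ_{j<k} a j)·Σ_{b∈C 0} ‖G 0 b‖²` — at d = 3 the factor is `L^{−k}`, the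
volume-free local contraction that the sparse Λ-channel of H2-1ˢ samples on the blocks under the level-`l` sites.
[cite: Balaban1984PropagatorsI, (1.18)-(1.20) pp.19-20; Balaban1985Averaging, Prop. 3 (124)-(126) p.36] -/
theorem sum_normSq_reduced_le_local (a : ℕ → ℝ) (ha0 : ∀ j, 0 ≤ a j) {k : ℕ} (hk : k ≤ P.m + P.K)
    (C : (i : ℕ) → Finset (PBond P i))
    (hnest : ∀ i < k, ∀ c ∈ C (i + 1), ∀ b : PBond P i, (blockOf b.src = c.src ∨ blockOf b.src = c.tgt) → b ∈ C i)
    (hα : ∀ j < k, ∀ c ∈ C (j + 1), ∀ i : Idx P,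
        dist1 (loopHol (Averaging.iter (fun i => blockAvg (P := P) (j := i) (expMeanLogSU (n := n))) j U₀) c i) ≤ a j)
    (ha24 : ∀ j < k, a j ≤ 1 / 24) (haN : ∀ j < k, a j < deltaSU n) :
    ∑ c ∈ C k, ‖G k c‖ ^ 2
      ≤ (((P.L : ℝ) ^ P.d)⁻¹ * (P.L : ℝ) ^ 2) ^ k
        * Real.exp (2 * ((159 * (((P.d + 2) * P.L : ℕ) : ℝ) * Real.sqrt (2 * P.d * (P.L : ℝ) ^ P.d * (2 * P.d)))
            / Real.sqrt (((P.L : ℝ) ^ P.d)⁻¹ * (P.L : ℝ) ^ 2) * ∑ j ∈ Finset.range k, a j))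
        * ∑ b ∈ C 0, ‖G 0 b‖ ^ 2 := by
  have hLpos : (0 : ℝ) < (P.L : ℝ) := by exact_mod_cast P.L_pos
  have hcL : (0 : ℝ) ≤ ((P.L : ℝ) ^ P.d)⁻¹ * (P.L : ℝ) ^ 2 := by positivity
  have h := sqrt_sum_normSq_reduced_le_local U₀ G hGs a ha0 hk C hnest hα ha24 haN
  set ρ : ℝ := Real.sqrt (((P.L : ℝ) ^ P.d)⁻¹ * (P.L : ℝ) ^ 2) with hρ
  set E : ℝ := Real.exp ((159 * (((P.d + 2) * P.L : ℕ) : ℝ) * Real.sqrt (2 * P.d * (P.L : ℝ) ^ P.d * (2 * P.d))) / ρ * ∑ j ∈ Finset.range k, a j) with hE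
  have hS0 : 0 ≤ ∑ c ∈ C k, ‖G k c‖ ^ 2 := Finset.sum_nonneg fun c _ => sq_nonneg _
  have hT0 : 0 ≤ ∑ b ∈ C 0, ‖G 0 b‖ ^ 2 := Finset.sum_nonneg fun b _ => sq_nonneg _
  have hrhs0 : 0 ≤ ρ ^ k * E * Real.sqrt (∑ b ∈ C 0, ‖G 0 b‖ ^ 2) := by positivity
  -- square both sides
  have hsq := pow_le_pow_left₀ (Real.sqrt_nonneg _) h 2
  rw [Real.sq_sqrt hS0] at hsq
  have hρ2 : ρ ^ 2 = ((P.L : ℝ) ^ P.d)⁻¹ * (P.L : ℝ) ^ 2 := by rw [hρ, Real.sq_sqrt hcL]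
  have hE2 : E ^ 2 = Real.exp (2 * ((159 * (((P.d + 2) * P.L : ℕ) : ℝ) * Real.sqrt (2 * P.d * (P.L : ℝ) ^ P.d * (2 * P.d))) / ρ
      * ∑ j ∈ Finset.range k, a j)) := by
    rw [hE, ← Real.exp_nat_mul]; norm_num
  calc _ ≤ (ρ ^ k * E * Real.sqrt (∑ b ∈ C 0, ‖G 0 b‖ ^ 2)) ^ 2 := hsq
    _ = (ρ ^ 2) ^ k * E ^ 2 * Real.sqrt (∑ b ∈ C 0, ‖G 0 b‖ ^ 2) ^ 2 := by ring
    _ = _ := by rw [hρ2, hE2, Real.sq_sqrt hT0]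

end Sourceless

end Summit.QuantumFields.YangMills.Theorems.Prop7TrueLinIterLocalL2

end
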